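import Summits.HodgeConjecture.CorCM.IrreducibleOddWeightsMultiplicityCriterion
import Literature.AlgebraicGeometry.Pohlmann1968.NondegenerateCMAlgebraTypes
import HarnessLib

/-!
# A product of CM abelian varieties is nondegenerate iff every factor is and, irreducible by irreducible, the slot
# evaluation spaces are independent — a finite, computable criterion

COR-CM (cell `pub-hodgecm2`, binder seat `b16` gen 57, count-neutral claim MULTIPLICITY, file F9 — sequel of F8
`CorCM/IrreducibleOddWeightsMultiplicityCriterion` and F4 `…MultiplicityFamilies` (local notation `Ev[G, π, w]` evaluation
space); theorems only, no definition, no named fact, no `sorry`).  NEW as stated, hence under `Summits/`.  HONEST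
FRAMING: a decidable nondegeneracy criterion for FAMILIES of CM types "for NAMED configurations" (kernel,
unconditional) for INT-4 «what is known» — nondegenerate family = `Hg(∏_i A_i) = ∏_i Hg(A_i)` of dimension
`Σ_i dim A_i` (then the Hodge conjecture holds on all products of the `A_i`, tree
`CMAlgebra.IsNondegenerateFamily.…`); `HC_CM` is neither used nor asserted.

The tree's evaluation criterion (`Literature/…/CMTypeRankEvaluationCriterion`: additive iff the slot evaluation spaces are
independent in EVERY irreducible `ℚ`-representation — a quantifier over a proper class of representations) becomes a
FINITE test over any covering list of irreducibles:

* **`typeRank_sigmaType_eq_iff_forall_and`** (abstract, any slots): for pairwise non-isomorphic irreducible `(π_k, V_k)`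
  covering every member `U(Φ_i)`:  `rank(Σ) = |⊔E_i|/2 + 1` **iff** every member is nondegenerate
  (`rank(Φ_i) = |E_i|/2 + 1`) **and** `dim Σ_i Ev_i(π_k) = Σ_i dim Ev_i(π_k)` for every `k` (the slot evaluation spaces
  are independent in each `V_k`).  With F8 (members, on transitive slots: `dim A_{Φ_i,k} V_k^{H_i} = dim B_{i,k} V_k^{H_i}`)
  and F5 (`Ev_i(π_k) = A_{Φ_i,k} V_k^{H_i}`) every quantity is the rank of an explicit operator on `H_i`-invariants:
  **`typeRank_sigmaType_eq_iff_forall_finrank_map`**.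
* CM fields: **`isNondegenerateFamily_iff_forall_and`** (`IsNondegenerateFamily Φ ⟺ (∀ i, IsNondegenerate (Φ i)) ∧
  ∀ k, dim Σ_i Ev_i(π_k) = Σ_i dim Ev_i(π_k)`) and **`isNondegenerateFamily_iff_forall_finrank_map`** (base embeddings
  `x_i`, sections `s_i`: `IsNondegenerateFamily Φ ⟺ ∀ k, (∀ i, dim A_{i,k} V_k^{H_i} = dim B_{i,k} V_k^{H_i}) ∧
  dim Σ_i A_{i,k} V_k^{H_i} = Σ_i dim A_{i,k} V_k^{H_i}`).

## References

* [Mai1989] L. Mai, *Lower bounds for the ranks of CM types*, J. Number Theory 32 (1989), §2 Prop. 1 (proof).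
* [Kubota1965] T. Kubota, *On the field extension by complex multiplication*, Trans. AMS 118 (1965), Lemma 2.
* [Gordon1999HodgeAVSurvey] B. B. Gordon, *A survey of the Hodge conjecture for abelian varieties*, §3, 7.5–7.7, 9.4.
* [Deligne1982HodgeCycles] P. Deligne, *Hodge cycles on abelian varieties*, LNM 900 (1982), I Ex. 3.7 (c).
-/

set_option autoImplicit false

noncomputable section

open scoped BigOperators

open NumberField

universe u u' v w

namespace Summit.HodgeConjecture.CorCM.IrrOdd

open Literature.NumberTheory.ComplexMultiplication

variable {G : Type w} [Group G]

/-- The evaluation space `Ev[G, π, w] = {T w : T equivariant}` (local notation, no definition). -/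
local notation3 (prettyPrint := false) "Ev[" G' ", " π ", " w "]" =>
  Submodule.span ℚ {v | ∃ T : (_ → ℚ) →ₗ[ℚ] _,
    (∀ (g : G') (f : _ → ℚ), T (fun x => f (g⁻¹ • x)) = π g (T f)) ∧ T w = v}

variable {I : Type u} {E : I → Type v} [∀ i, MulAction G (E i)] [Fintype I] [∀ i, Fintype (E i)]
  {K : Type u'} [Fintype K] {V : K → Type*} [∀ k, AddCommGroup (V k)] [∀ k, Module ℚ (V k)]
  [∀ k, FiniteDimensional ℚ (V k)]

/-! ### §0 Bookkeeping -/

/-- Subadditivity of dimension over a finite supremum: `dim (⨆_i S_i) ≤ Σ_i dim S_i`. [folklore] -/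
theorem finrank_iSup_le_sum_finrank {W : Type*} [AddCommGroup W] [Module ℚ W] [FiniteDimensional ℚ W]
    (S : I → Submodule ℚ W) :
    Module.finrank ℚ (⨆ i, S i : Submodule ℚ W) ≤ ∑ i, Module.finrank ℚ (S i) := by
  classical
  rw [← Finset.sup_univ_eq_iSup]
  suffices h : ∀ t : Finset I, Module.finrank ℚ (t.sup S : Submodule ℚ W) ≤ ∑ i ∈ t, Module.finrank ℚ (S i) from
    h _
  intro t
  induction t using Finset.induction_on with
  | empty => rw [Finset.sup_empty, Finset.sum_empty, finrank_bot]
  | insert a t ha ih =>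
    rw [Finset.sup_insert, Finset.sum_insert ha]
    exact (Submodule.finrank_add_le_finrank_add_finrank _ _).trans (Nat.add_le_add_left ih _)

/-! ### §1 Nondegenerate family ⟺ nondegenerate members and independent slot evaluation spaces -/

/-- **NONDEGENERACY OF A FAMILY IS A FINITE TEST.**  For pairwise non-isomorphic irreducible `(π_k, V_k)` covering every
member `U(Φ_i)` of a family of CM types (`ρ`-types on the slots `E_i`):  `rank(Σ) = |⊔_i E_i|/2 + 1` iff every member
has `rank(Φ_i) = |E_i|/2 + 1` AND `dim Σ_i Ev_i(π_k) = Σ_i dim Ev_i(π_k)` for every `k` — on Hodge groups: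
`dim Hg(∏_i A_i) = Σ_i dim A_i` iff `dim Hg(A_i) = dim A_i` for all `i` and the slot evaluation spaces are independent
in each `V_k`.  (`dim U(Σ) = Σ_k d_k dim(Σ_i Ev_i)/δ_k ≤ Σ_k d_k (Σ_i dim Ev_i)/δ_k = Σ_i dim U(Φ_i) ≤ Σ_i |E_i|/2`,
with equality throughout iff termwise.) [cite: Mai1989, §2 Prop. 1 (proof)] [cite: Gordon1999HodgeAVSurvey, §3 and 7.5–7.7] -/
theorem typeRank_sigmaType_eq_iff_forall_and [Nonempty (Σ i, E i)] [∀ i, Nonempty (E i)] {ρ : G}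
    {Φ : ∀ i, Set (E i)} (h : ∀ i, IsCMTypeWith ρ (Φ i)) (π : ∀ k, Representation ℚ G (V k))
    (hirr : ∀ k, (π k).IsIrreducible) (hne : ∀ k l, k ≠ l → ∀ S : (π k).IntertwiningMap (π l), S = 0)
    (hcov : ∀ (i : I) (P : Submodule ℚ (E i → ℚ)), P ≤ antiSpan G (Φ i) → P ≠ ⊥ →
      (∀ (g : G) (a : E i → ℚ), a ∈ P → (fun s => a (g • s)) ∈ P) →
      ∃ k, ∃ T : (E i → ℚ) →ₗ[ℚ] V k,
        (∀ (g : G) (a : E i → ℚ), T (fun s => a (g⁻¹ • s)) = π k g (T a)) ∧ ∃ a ∈ P, T a ≠ 0) :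
    typeRank G (sigmaType Φ) = Fintype.card (Σ i, E i) / 2 + 1 ↔
      (∀ i, typeRank G (Φ i) = Fintype.card (E i) / 2 + 1) ∧
        ∀ k, Module.finrank ℚ (⨆ i, Ev[G, π k, antiVec (Φ i) (1 : G)] : Submodule ℚ (V k)) =
          ∑ i, Module.finrank ℚ Ev[G, π k, antiVec (Φ i) (1 : G)] := by
  classical
  -- the multiplicity formulas for the family and for each member
  obtain ⟨hdS, hS⟩ := finrank_antiSpan_sigmaType_eq_sum Φ π hirr hne (cover_sigmaType_of_forall Φ π hcov)
  have hmem : ∀ i, (∀ k, Module.finrank ℚ ((π k).IntertwiningMap (π k)) ∣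
      Module.finrank ℚ Ev[G, π k, antiVec (Φ i) (1 : G)]) ∧
      Module.finrank ℚ (antiSpan G (Φ i)) = ∑ k, Module.finrank ℚ (V k) *
        (Module.finrank ℚ Ev[G, π k, antiVec (Φ i) (1 : G)] / Module.finrank ℚ ((π k).IntertwiningMap (π k))) :=
    fun i => finrank_antiSpan_eq_sum (Φ i) π hirr hne (hcov i)
  -- ranks versus dimensions
  have hrS := (IsCMTypeWith.sigmaType h).typeRank_eq_finrank_antiSpan_add_one (G := G)
  have hri : ∀ i, typeRank G (Φ i) = Module.finrank ℚ (antiSpan G (Φ i)) + 1 := fun i =>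
    (h i).typeRank_eq_finrank_antiSpan_add_one
  have hcard : Fintype.card (Σ i, E i) / 2 = ∑ i, Fintype.card (E i) / 2 := card_sigma_div_two h
  -- the two termwise inequalities
  have hle1 : ∀ k, Module.finrank ℚ (⨆ i, Ev[G, π k, antiVec (Φ i) (1 : G)] : Submodule ℚ (V k)) ≤
      ∑ i, Module.finrank ℚ Ev[G, π k, antiVec (Φ i) (1 : G)] := fun k =>
    finrank_iSup_le_sum_finrank _
  have hle2 : ∀ i, Module.finrank ℚ (antiSpan G (Φ i)) ≤ Fintype.card (E i) / 2 := fun i => by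
    have h1 := (h i).typeRank_le (G := G)
    rw [hri i] at h1
    omega
  -- `Σ_i dim U(Φ_i)` regrouped over `k`
  have hsum : ∑ i, Module.finrank ℚ (antiSpan G (Φ i)) = ∑ k, Module.finrank ℚ (V k) *
      ((∑ i, Module.finrank ℚ Ev[G, π k, antiVec (Φ i) (1 : G)]) / Module.finrank ℚ ((π k).IntertwiningMap (π k))) := by
    rw [Finset.sum_congr rfl fun i _ => (hmem i).2, Finset.sum_comm]
    refine Finset.sum_congr rfl fun k _ => ?_
    rw [← Finset.mul_sum, ← Nat.sum_div fun i _ => (hmem i).1 k]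
  have hdvd2 : ∀ k, Module.finrank ℚ ((π k).IntertwiningMap (π k)) ∣
      ∑ i, Module.finrank ℚ Ev[G, π k, antiVec (Φ i) (1 : G)] := fun k =>
    Finset.dvd_sum fun i _ => (hmem i).1 k
  -- chain: `dim U(Σ) ≤ Σ_i dim U(Φ_i) ≤ Σ_i |E_i|/2`
  have hA : Module.finrank ℚ (antiSpan G (sigmaType Φ)) ≤ ∑ i, Module.finrank ℚ (antiSpan G (Φ i)) :=
    finrank_antiSpan_sigmaType_le Φ
  have hB : ∑ i, Module.finrank ℚ (antiSpan G (Φ i)) ≤ ∑ i, Fintype.card (E i) / 2 :=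
    Finset.sum_le_sum fun i _ => hle2 i
  rw [hrS, hcard]
  constructor
  · intro hnd
    have hnd' : Module.finrank ℚ (antiSpan G (sigmaType Φ)) = ∑ i, Fintype.card (E i) / 2 := by omega
    have heqA : Module.finrank ℚ (antiSpan G (sigmaType Φ)) = ∑ i, Module.finrank ℚ (antiSpan G (Φ i)) :=
      le_antisymm hA (hnd' ▸ hB)
    have heqB : ∑ i, Module.finrank ℚ (antiSpan G (Φ i)) = ∑ i, Fintype.card (E i) / 2 := by omega
    refine ⟨fun i => ?_, ?_⟩
    · rw [hri i, (Finset.sum_eq_sum_iff_of_le fun i _ => hle2 i).1 heqB i (Finset.mem_univ i)]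
    · rw [hS, hsum] at heqA
      exact forall_eq_of_sum_mul_div_eq (fun k => finrank_pos_of_isIrreducible (π k) (hirr k)) hdS hdvd2 hle1 heqA
  · rintro ⟨hmemnd, hind⟩
    have heqA : Module.finrank ℚ (antiSpan G (sigmaType Φ)) = ∑ i, Module.finrank ℚ (antiSpan G (Φ i)) := by
      rw [hS, hsum]
      exact Finset.sum_congr rfl fun k _ => by rw [hind k]
    have heqB : ∑ i, Module.finrank ℚ (antiSpan G (Φ i)) = ∑ i, Fintype.card (E i) / 2 :=
      Finset.sum_congr rfl fun i _ => by have := hmemnd i; rw [hri i] at this; omega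
    omega

/-- **THE COMPUTABLE FORM on transitive CM slots** (base points `x_i`, sections `s_i`, stabilisers `H_i`, conjugation
`ρ`, irreducibles covering the odd weights of every slot):  `rank(Σ) = |⊔_i E_i|/2 + 1` iff for every `k`,
**`dim A_{i,k} V_k^{H_i} = dim B_{i,k} V_k^{H_i}` for all `i` (members nondegenerate) and
`dim Σ_i A_{i,k} V_k^{H_i} = Σ_i dim A_{i,k} V_k^{H_i}`** (independence), where `A_{i,k} = Σ_y u_1(Φ_i)(y) π_k(s_i y)`
and `B_{i,k} = Σ_y (δ_{x_i} − δ_{ρx_i})(y) π_k(s_i y)`. [cite: Mai1989, §2 Prop. 1] [cite: Kubota1965, Lemma 2] -/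
theorem typeRank_sigmaType_eq_iff_forall_finrank_map [Nonempty (Σ i, E i)] [∀ i, DecidableEq (E i)] {ρ : G}
    {Φ : ∀ i, Set (E i)} (h : ∀ i, IsCMTypeWith ρ (Φ i)) (x : ∀ i, E i) (s : ∀ i, E i → G)
    (hs : ∀ i y, s i y • x i = y) (π : ∀ k, Representation ℚ G (V k))
    (hirr : ∀ k, (π k).IsIrreducible) (hne : ∀ k l, k ≠ l → ∀ S : (π k).IntertwiningMap (π l), S = 0)
    (hcov : ∀ (i : I) (P : Submodule ℚ (E i → ℚ)), P ≤ antiWeights (E := E i) ρ → P ≠ ⊥ →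
      (∀ (g : G) (a : E i → ℚ), a ∈ P → (fun s => a (g • s)) ∈ P) →
      ∃ k, ∃ T : (E i → ℚ) →ₗ[ℚ] V k,
        (∀ (g : G) (a : E i → ℚ), T (fun s => a (g⁻¹ • s)) = π k g (T a)) ∧ ∃ a ∈ P, T a ≠ 0) :
    typeRank G (sigmaType Φ) = Fintype.card (Σ i, E i) / 2 + 1 ↔ ∀ k,
      (∀ i, Module.finrank ℚ ((Representation.invariants ((π k).comp (MulAction.stabilizer G (x i)).subtype)).map
            (∑ y, antiVec (Φ i) (1 : G) y • π k (s i y))) =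
          Module.finrank ℚ ((Representation.invariants ((π k).comp (MulAction.stabilizer G (x i)).subtype)).map
            (∑ y, ((Pi.single (x i) (1 : ℚ) : E i → ℚ) y - (Pi.single (ρ • x i) (1 : ℚ) : E i → ℚ) y) •
              π k (s i y)))) ∧
      Module.finrank ℚ (⨆ i, (Representation.invariants ((π k).comp (MulAction.stabilizer G (x i)).subtype)).map
            (∑ y, antiVec (Φ i) (1 : G) y • π k (s i y)) : Submodule ℚ (V k)) =
        ∑ i, Module.finrank ℚ ((Representation.invariants ((π k).comp (MulAction.stabilizer G (x i)).subtype)).map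
            (∑ y, antiVec (Φ i) (1 : G) y • π k (s i y))) := by
  haveI : ∀ i, Nonempty (E i) := fun i => ⟨x i⟩
  have hcov' : ∀ (i : I) (P : Submodule ℚ (E i → ℚ)), P ≤ antiSpan G (Φ i) → P ≠ ⊥ →
      (∀ (g : G) (a : E i → ℚ), a ∈ P → (fun s => a (g • s)) ∈ P) →
      ∃ k, ∃ T : (E i → ℚ) →ₗ[ℚ] V k,
        (∀ (g : G) (a : E i → ℚ), T (fun s => a (g⁻¹ • s)) = π k g (T a)) ∧ ∃ a ∈ P, T a ≠ 0 :=
    fun i P hP => hcov i P (hP.trans (antiSpan_le_antiWeights' (h i)))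
  rw [typeRank_sigmaType_eq_iff_forall_and h π hirr hne hcov']
  -- rewrite the three kinds of quantities through F5/F8
  have hEv : ∀ k i, Ev[G, π k, antiVec (Φ i) (1 : G)] =
      (Representation.invariants ((π k).comp (MulAction.stabilizer G (x i)).subtype)).map
        (∑ y, antiVec (Φ i) (1 : G) y • π k (s i y)) := fun k i => evalSpace_eq_map_invariants (π k) (hs i) _
  have hmem : ∀ i, typeRank G (Φ i) = Fintype.card (E i) / 2 + 1 ↔ ∀ k,
      Module.finrank ℚ ((Representation.invariants ((π k).comp (MulAction.stabilizer G (x i)).subtype)).map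
          (∑ y, antiVec (Φ i) (1 : G) y • π k (s i y))) =
        Module.finrank ℚ ((Representation.invariants ((π k).comp (MulAction.stabilizer G (x i)).subtype)).map
          (∑ y, ((Pi.single (x i) (1 : ℚ) : E i → ℚ) y - (Pi.single (ρ • x i) (1 : ℚ) : E i → ℚ) y) •
            π k (s i y))) := fun i =>
    typeRank_eq_iff_forall_finrank_map_eq (h i) (hs i) π hirr hne (hcov i)
  have hsup : ∀ k, (⨆ i, Ev[G, π k, antiVec (Φ i) (1 : G)] : Submodule ℚ (V k)) =
      ⨆ i, (Representation.invariants ((π k).comp (MulAction.stabilizer G (x i)).subtype)).map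
        (∑ y, antiVec (Φ i) (1 : G) y • π k (s i y)) := fun k => iSup_congr fun i => hEv k i
  constructor
  · rintro ⟨hnd, hind⟩ k
    refine ⟨fun i => (hmem i).1 (hnd i) k, ?_⟩
    have h1 := hind k
    rw [hsup k] at h1
    rw [h1]
    exact Finset.sum_congr rfl fun i _ => by rw [hEv k i]
  · intro hall
    refine ⟨fun i => (hmem i).2 fun k => (hall k).1 i, fun k => ?_⟩
    rw [hsup k, (hall k).2]
    exact Finset.sum_congr rfl fun i _ => by rw [hEv k i]

end Summit.HodgeConjecture.CorCM.IrrOdd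

/-! ### §2 CM fields -/

namespace Summit.HodgeConjecture.CorCM

open Literature.NumberTheory.ComplexMultiplication
open Literature.AlgebraicGeometry.Motives (CMType)
open Literature.AlgebraicGeometry.Pohlmann1968

/-- The evaluation space `Ev[G, π, w] = {T w : T equivariant}` (local notation, no definition). -/
local notation3 (prettyPrint := false) "Ev[" G' ", " π ", " w "]" =>
  Submodule.span ℚ {v | ∃ T : (_ → ℚ) →ₗ[ℚ] _,
    (∀ (g : G') (f : _ → ℚ), T (fun x => f (g⁻¹ • x)) = π g (T f)) ∧ T w = v}

variable {I : Type} [Fintype I] {K : I → Type} [∀ i, Field (K i)] [∀ i, NumberField (K i)] [∀ i, IsCMField (K i)]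
  {κ : Type u'} [Fintype κ] {V : κ → Type*} [∀ k, AddCommGroup (V k)] [∀ k, Module ℚ (V k)]
  [∀ k, FiniteDimensional ℚ (V k)]

/-- **`IsNondegenerateFamily Φ ⟺ (∀ i, IsNondegenerate (Φ i)) ∧ ∀ k, dim Σ_i Ev_i(π_k) = Σ_i dim Ev_i(π_k)`**
for irreducibles of `Aut(ℂ)` covering every member: `Hg(∏_i A_i) = ∏_i Hg(A_i)` with `dim Hg(A_i) = dim A_i` is the
finite test "members nondegenerate, slot evaluation spaces independent in each `V_k`".
[cite: Mai1989, §2 Prop. 1 (proof)] [cite: Gordon1999HodgeAVSurvey, §3 and 7.5–7.7] -/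
theorem isNondegenerateFamily_iff_forall_and [Nonempty I] (Φ : ∀ i, CMType (K i))
    (π : ∀ k, Representation ℚ (ℂ ≃+* ℂ) (V k)) (hirr : ∀ k, (π k).IsIrreducible)
    (hne : ∀ k l, k ≠ l → ∀ S : (π k).IntertwiningMap (π l), S = 0)
    (hcov : ∀ (i : I) (P : Submodule ℚ ((K i →+* ℂ) → ℚ)), P ≤ antiSpan (ℂ ≃+* ℂ) (Φ i).1 → P ≠ ⊥ →
      (∀ (g : ℂ ≃+* ℂ) (a : (K i →+* ℂ) → ℚ), a ∈ P → (fun s => a (g • s)) ∈ P) →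
      ∃ k, ∃ T : ((K i →+* ℂ) → ℚ) →ₗ[ℚ] V k,
        (∀ (g : ℂ ≃+* ℂ) (a : (K i →+* ℂ) → ℚ), T (fun s => a (g⁻¹ • s)) = π k g (T a)) ∧ ∃ a ∈ P, T a ≠ 0) :
    CMAlgebra.IsNondegenerateFamily Φ ↔
      (∀ i, IsNondegenerate (Φ i)) ∧
        ∀ k, Module.finrank ℚ (⨆ i, Ev[ℂ ≃+* ℂ, π k, antiVec (Φ i).1 (1 : ℂ ≃+* ℂ)] : Submodule ℚ (V k)) =
          ∑ i, Module.finrank ℚ Ev[ℂ ≃+* ℂ, π k, antiVec (Φ i).1 (1 : ℂ ≃+* ℂ)] := by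
  obtain ⟨i₀⟩ := ‹Nonempty I›
  obtain ⟨s₀⟩ : Nonempty (K i₀ →+* ℂ) := inferInstance
  haveI : Nonempty (Σ i, (K i →+* ℂ)) := ⟨⟨i₀, s₀⟩⟩
  haveI : ∀ i, Nonempty (K i →+* ℂ) := fun i => inferInstance
  have hcardS : Fintype.card (Σ i, (K i →+* ℂ)) = ∑ i, Module.finrank ℚ (K i) := by
    rw [Fintype.card_sigma]
    exact Finset.sum_congr rfl fun i _ => Embeddings.card (K i) ℂ
  rw [CMAlgebra.isNondegenerateFamily_iff, ← hcardS]
  change typeRank (ℂ ≃+* ℂ) (sigmaType fun i => (Φ i).1) = _ ↔ _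
  rw [IrrOdd.typeRank_sigmaType_eq_iff_forall_and (E := fun i => K i →+* ℂ) (fun i => isCMTypeWith_conj (Φ i)) π
    hirr hne hcov]
  refine and_congr (forall_congr' fun i => ?_) Iff.rfl
  rw [isNondegenerate_iff, ← Embeddings.card (K i) ℂ]
  rfl

open scoped Classical in
/-- **THE COMPUTABLE FORM for products of CM abelian varieties** (base embeddings `x_i`, sections `s_i`
(`exists_section_embeddings`), stabilisers `H_i = Stab(x_i)`, irreducibles covering the odd weights of every `Hom(K_i, ℂ)`):
**`IsNondegenerateFamily Φ` iff for every `k`, `dim A_{i,k} V_k^{H_i} = dim B_{i,k} V_k^{H_i}` for all `i` and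
`dim Σ_i A_{i,k} V_k^{H_i} = Σ_i dim A_{i,k} V_k^{H_i}`**, `A_{i,k} = Σ_y u_1(Φ_i)(y) π_k(s_i y)`,
`B_{i,k} = Σ_y (δ_{x_i} − δ_{x̄_i})(y) π_k(s_i y)` — then `Hg(∏_i A_i) = ∏_i Hg(A_i)` has dimension `Σ_i dim A_i`
and the Hodge conjecture holds on every product of the `A_i` (tree). [cite: Mai1989, §2 Prop. 1] [cite: Kubota1965, Lemma 2]
[cite: Gordon1999HodgeAVSurvey, 7.5–7.7] -/
theorem isNondegenerateFamily_iff_forall_finrank_map [Nonempty I] (Φ : ∀ i, CMType (K i)) (x : ∀ i, K i →+* ℂ)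
    (s : ∀ i, (K i →+* ℂ) → (ℂ ≃+* ℂ)) (hs : ∀ i y, s i y • x i = y)
    (π : ∀ k, Representation ℚ (ℂ ≃+* ℂ) (V k)) (hirr : ∀ k, (π k).IsIrreducible)
    (hne : ∀ k l, k ≠ l → ∀ S : (π k).IntertwiningMap (π l), S = 0)
    (hcov : ∀ (i : I) (P : Submodule ℚ ((K i →+* ℂ) → ℚ)),
      P ≤ antiWeights (E := K i →+* ℂ) (starRingAut : ℂ ≃+* ℂ) → P ≠ ⊥ →
      (∀ (g : ℂ ≃+* ℂ) (a : (K i →+* ℂ) → ℚ), a ∈ P → (fun y => a (g • y)) ∈ P) →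
      ∃ k, ∃ T : ((K i →+* ℂ) → ℚ) →ₗ[ℚ] V k,
        (∀ (g : ℂ ≃+* ℂ) (a : (K i →+* ℂ) → ℚ), T (fun y => a (g⁻¹ • y)) = π k g (T a)) ∧ ∃ a ∈ P, T a ≠ 0) :
    CMAlgebra.IsNondegenerateFamily Φ ↔ ∀ k,
      (∀ i, Module.finrank ℚ ((Representation.invariants
              ((π k).comp (MulAction.stabilizer (ℂ ≃+* ℂ) (x i)).subtype)).map
            (∑ y, antiVec (Φ i).1 (1 : ℂ ≃+* ℂ) y • π k (s i y))) =
          Module.finrank ℚ ((Representation.invariants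
              ((π k).comp (MulAction.stabilizer (ℂ ≃+* ℂ) (x i)).subtype)).map
            (∑ y, ((Pi.single (x i) (1 : ℚ) : (K i →+* ℂ) → ℚ) y -
              (Pi.single ((starRingAut : ℂ ≃+* ℂ) • x i) (1 : ℚ) : (K i →+* ℂ) → ℚ) y) • π k (s i y)))) ∧
      Module.finrank ℚ (⨆ i, (Representation.invariants
              ((π k).comp (MulAction.stabilizer (ℂ ≃+* ℂ) (x i)).subtype)).map
            (∑ y, antiVec (Φ i).1 (1 : ℂ ≃+* ℂ) y • π k (s i y)) : Submodule ℚ (V k)) =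
        ∑ i, Module.finrank ℚ ((Representation.invariants
              ((π k).comp (MulAction.stabilizer (ℂ ≃+* ℂ) (x i)).subtype)).map
            (∑ y, antiVec (Φ i).1 (1 : ℂ ≃+* ℂ) y • π k (s i y))) := by
  classical
  obtain ⟨i₀⟩ := ‹Nonempty I›
  haveI : Nonempty (Σ i, (K i →+* ℂ)) := ⟨⟨i₀, x i₀⟩⟩
  have hcardS : Fintype.card (Σ i, (K i →+* ℂ)) = ∑ i, Module.finrank ℚ (K i) := by
    rw [Fintype.card_sigma]
    exact Finset.sum_congr rfl fun i _ => Embeddings.card (K i) ℂ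
  rw [CMAlgebra.isNondegenerateFamily_iff, ← hcardS]
  change typeRank (ℂ ≃+* ℂ) (sigmaType fun i => (Φ i).1) = _ ↔ _
  exact IrrOdd.typeRank_sigmaType_eq_iff_forall_finrank_map (E := fun i => K i →+* ℂ)
    (fun i => isCMTypeWith_conj (Φ i)) x s hs π hirr hne hcov

end Summit.HodgeConjecture.CorCM

end
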